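import Literature.AlgebraicGeometry.ComplexMultiplication.CMFieldActionHOne
import Summits.HodgeConjecture.CorCM.MumfordTateRankRigidMonotone
import Summits.HodgeConjecture.CorCM.MumfordTateRankTimesCMCurve
import HarnessLib

/-!
# Quadratic field actions on `H¹`: the ring homomorphism `c ↦ b`, joint eigenspaces and multiplicities through a generator
# (bookkeeping shared by the same-field Weil-class cells of the Mumford–Tate-rank ladder)

COR-CM (cell `pub-hodgecm2`, seat `b27` gen 48, count-neutral Mumford–Tate-rank ladder; theorems only, no definition, no named fact;
UNCONDITIONAL — nothing here uses or asserts HC_CM).  For a quadratic `ℚ`-algebra `K = ℚ ⊕ ℚc` with `c² = −D` (`D > 0`):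
* `exists_eq_smul_one_add_smul_of_sq_eq_neg` (`K = ℚ1 + ℚc`), **`exists_ringHom_apply_eq_of_sq_eq_neg`** (`K →+* R`, `c ↦ b` for any `b² = −D`
  in a `ℚ`-algebra `R` — used with `R = End⁰A`);
* for `ρ : K →+* End⁰A` with `ρ c = ψ`: **`iInf_eigenspace_hOneAlgHom_eq`** (the joint `σ`-eigenspace of the action `hOneEndAction ρ` on
  `H¹(A) ⊗ ℂ` is the `σ(c)`-eigenspace of `ψ^*_ℂ`), **`multiplicity_hOneEndAction_eq_eigenMultiplicity`** (`n_σ = eigenMultiplicity A ψ (σ c)`),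
  `apply_eq_or_eq_neg_of_sq_eq_neg` (`σ(c) = ± i√D`).
Consumers: `CorCM/MumfordTateRankTimesCMCurveSameField` (`E_CM × T_IV(2,1)`, same field: `t = 10`), `CorCM/MumfordTateRankTypeIVThreefoldPairs`,
`CorCM/MumfordTateRankRibetTimesCMCurveSameField`.

## References
* [Deligne1982HodgeCycles] P. Deligne, LNM 900 (1982), §4 Prop. 4.4 (the multiplicities `n_σ`). [cite: Deligne1982HodgeCycles, §4 Prop. 4.4]
* [MoonenZarhin1999LowDim] B. Moonen, Yu. G. Zarhin, Math. Ann. 315 (1999), §2 (2.3). [cite: MoonenZarhin1999LowDim, §2 (2.3)]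
-/

noncomputable section

open scoped TensorProduct
open CategoryTheory CategoryTheory.Limits Module

namespace Summit.HodgeConjecture.CorCM

open Literature.AlgebraicGeometry.Motives
open Literature.AlgebraicGeometry.Motives.AbelianVariety
open Literature.AlgebraicGeometry.Motives.HodgeStructure
open Literature.AlgebraicGeometry.HodgeTheory
open Literature.AlgebraicGeometry.ComplexMultiplication

/-! ## §1 Quadratic actions: the ring homomorphism `c ↦ b`, joint eigenspaces and multiplicities through a generator -/

section Quadratic

/-- `(x + yc)(x' + y'c) = (xx' − Dyy') + (xy' + x'y)c` in a `ℚ`-algebra with `c² = −D`. [folklore] -/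
private theorem quadratic_mul_expand' {S : Type*} [Ring S] [Algebra ℚ S] {e : S} {d' : ℚ} (he : e * e = -(d' • 1))
    (x y x' y' : ℚ) :
    (x • (1 : S) + y • e) * (x' • 1 + y' • e) = (x * x' - d' * (y * y')) • 1 + (x * y' + x' * y) • e := by
  simp only [add_mul, mul_add, smul_mul_smul_comm, one_mul, mul_one, he, smul_neg, smul_smul]
  module

/-- Every element of a two-dimensional `ℚ`-algebra `K ∋ c` with `c² = −D`, `D > 0`, is `x + yc` (`1, c` are linearly independent since
`−D` is not a rational square). [cite: Shimura1998, §5.1 Proposition 5 (p. 36)] -/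
theorem exists_eq_smul_one_add_smul_of_sq_eq_neg {K : Type*} [Ring K] [Algebra ℚ K] [Nontrivial K] [Module.Finite ℚ K]
    (hK : Module.finrank ℚ K = 2) {c : K} {D : ℚ} (hD : 0 < D) (hc : c * c = -(D • 1)) (z : K) : ∃ x y : ℚ, z = x • 1 + y • c := by
  classical
  have hli : LinearIndependent ℚ ![(1 : K), c] := by
    refine LinearIndependent.pair_iff.2 fun s t hst => ?_
    by_cases ht : t = 0
    · subst ht
      simp only [zero_smul, add_zero, smul_eq_zero, one_ne_zero, or_false] at hst
      exact ⟨hst, rfl⟩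
    · exfalso
      have hcst : c = (-(s / t)) • (1 : K) := by
        have h : t • c = -(s • (1 : K)) := eq_neg_of_add_eq_zero_right hst
        have h2 : c = t⁻¹ • (t • c) := by rw [smul_smul, inv_mul_cancel₀ ht, one_smul]
        rw [h2, h, smul_neg, smul_smul, neg_smul, div_eq_inv_mul]
      have hsq : ((s / t) ^ 2 + D) • (1 : K) = 0 := by
        rw [add_smul, ← neg_neg (D • (1 : K)), ← hc, hcst, smul_mul_smul_comm, one_mul, neg_mul_neg, ← sq, add_neg_cancel]
      rw [smul_eq_zero] at hsq
      rcases hsq with h | h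
      · nlinarith [sq_nonneg (s / t)]
      · exact one_ne_zero h
  have hcard : Fintype.card (Fin 2) = Module.finrank ℚ K := by rw [Fintype.card_fin, hK]
  set bK : Module.Basis (Fin 2) ℚ K := basisOfLinearIndependentOfCardEqFinrank hli hcard with hbK
  have hbK0 : bK 0 = 1 := by rw [hbK, coe_basisOfLinearIndependentOfCardEqFinrank]; rfl
  have hbK1 : bK 1 = c := by rw [hbK, coe_basisOfLinearIndependentOfCardEqFinrank]; rfl
  refine ⟨bK.repr z 0, bK.repr z 1, ?_⟩
  conv_lhs => rw [← bK.sum_repr z]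
  rw [Fin.sum_univ_two, hbK0, hbK1]

/-- **A two-dimensional `ℚ`-algebra `K ∋ c` with `c² = −D` (`D > 0`) maps to every `ℚ`-algebra `R ∋ b` with `b² = −D` by a ring homomorphism
WITH `c ↦ b`** (`x + yc ↦ x + yb`; the tree's `nonempty_ringHom_of_mul_self_eq_neg` with the value recorded — the «embedding of `k`» of
Moonen–Zarhin's Prop. (3.8)). [cite: MoonenZarhin1999LowDim, §3 Prop. (3.8)] [cite: Shimura1998, §5.1 Proposition 5 (p. 36)] -/
theorem exists_ringHom_apply_eq_of_sq_eq_neg {K R : Type*} [Ring K] [Algebra ℚ K] [Nontrivial K] [Module.Finite ℚ K]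
    (hK : Module.finrank ℚ K = 2) {c : K} {D : ℚ} (hD : 0 < D) (hc : c * c = -(D • 1)) [Ring R] [Algebra ℚ R] {b : R}
    (hb : b * b = -(D • 1)) : ∃ f : K →+* R, f c = b := by
  classical
  -- `1, c` are linearly independent
  have hli : LinearIndependent ℚ ![(1 : K), c] := by
    refine LinearIndependent.pair_iff.2 fun s t hst => ?_
    by_cases ht : t = 0
    · subst ht
      simp only [zero_smul, add_zero, smul_eq_zero, one_ne_zero, or_false] at hst
      exact ⟨hst, rfl⟩
    · exfalso
      have hcst : c = (-(s / t)) • (1 : K) := by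
        have h : t • c = -(s • (1 : K)) := eq_neg_of_add_eq_zero_right hst
        have h2 : c = t⁻¹ • (t • c) := by rw [smul_smul, inv_mul_cancel₀ ht, one_smul]
        rw [h2, h, smul_neg, smul_smul, neg_smul, div_eq_inv_mul]
      have hsq : ((s / t) ^ 2 + D) • (1 : K) = 0 := by
        rw [add_smul, ← neg_neg (D • (1 : K)), ← hc, hcst, smul_mul_smul_comm, one_mul, neg_mul_neg, ← sq, add_neg_cancel]
      rw [smul_eq_zero] at hsq
      rcases hsq with h | h
      · nlinarith [sq_nonneg (s / t)]
      · exact one_ne_zero h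
  have hcard : Fintype.card (Fin 2) = Module.finrank ℚ K := by rw [Fintype.card_fin, hK]
  set bK : Module.Basis (Fin 2) ℚ K := basisOfLinearIndependentOfCardEqFinrank hli hcard with hbK
  have hbK0 : bK 0 = 1 := by rw [hbK, coe_basisOfLinearIndependentOfCardEqFinrank]; rfl
  have hbK1 : bK 1 = c := by rw [hbK, coe_basisOfLinearIndependentOfCardEqFinrank]; rfl
  -- the linear map `x + yc ↦ x + yb`
  set f : K →ₗ[ℚ] R := bK.constr ℚ ![(1 : R), b] with hf
  have hf1 : f 1 = 1 := by
    rw [← hbK0, hf, Module.Basis.constr_basis]; rfl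
  have hfc : f c = b := by
    rw [← hbK1, hf, Module.Basis.constr_basis]; rfl
  have hfxy : ∀ x y : ℚ, f (x • 1 + y • c) = x • 1 + y • b := fun x y => by
    rw [map_add, map_smul, map_smul, hf1, hfc]
  have hspan : ∀ z : K, ∃ x y : ℚ, z = x • 1 + y • c := fun z => by
    refine ⟨bK.repr z 0, bK.repr z 1, ?_⟩
    conv_lhs => rw [← bK.sum_repr z]
    rw [Fin.sum_univ_two, hbK0, hbK1]
  refine ⟨{ toFun := f, map_one' := hf1, map_zero' := map_zero f, map_add' := map_add f, map_mul' := ?_ }, hfc⟩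
  intro z w
  obtain ⟨x, y, rfl⟩ := hspan z
  obtain ⟨x', y', rfl⟩ := hspan w
  rw [quadratic_mul_expand' hc, hfxy, hfxy, hfxy, quadratic_mul_expand' hb]

variable [HodgeTensorFacts.{0, 0}] {A : AbelianVariety ℂ} {K : Type} [Field K] [NumberField K]

omit [HodgeTensorFacts.{0, 0}] in
/-- **Joint eigenspaces through a generator**: for `ρ : K → End⁰A` with `K = ℚ + ℚc`, `c² = −D`, `ρ c = ψ`, the joint `σ`-eigenspace
`⨅_e ker((ρ e)^*_ℂ − σ(e))` of the action on `H¹(A) ⊗ ℂ` is the `σ(c)`-eigenspace of `ψ^*_ℂ`. [cite: Deligne1982HodgeCycles, §4 Prop. 4.4] -/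
theorem iInf_eigenspace_hOneAlgHom_eq (ρ : K →+* A.endAlgebra) (hK : Module.finrank ℚ K = 2) {c : K} {D : ℕ} (hD : 0 < D)
    (hc : c * c = -((D : ℚ) • 1)) (ψ : A ⟶ A) (hρc : ρ c = AbelianVariety.endAlgebra.of A ψ) (σ : K →+* ℂ) :
    (⨅ e, Module.End.eigenspace ((hOneAlgHom ρ e).baseChange ℂ) (σ e)) =
      Module.End.eigenspace ((bettiCohomology.map ψ.hom.hom.hom 1).hom.baseChange ℂ) (σ c) := by
  have hψ : hOneAlgHom ρ c = (bettiCohomology.map ψ.hom.hom.hom 1).hom := by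
    rw [hOneAlgHom_apply, hρc, bettiRep_of, MulOpposite.unop_op]
  refine le_antisymm ((iInf_le _ c).trans (by rw [hψ])) fun x hx => ?_
  rw [Module.End.mem_eigenspace_iff] at hx
  refine (Submodule.mem_iInf _).2 fun e => ?_
  obtain ⟨a, b, rfl⟩ := exists_eq_smul_one_add_smul_of_sq_eq_neg hK (Nat.cast_pos.2 hD) hc e
  -- the operator `ρ(a + bc)^* = a + b ψ^*` and the scalar `σ(a + bc) = a + b σ(c)`
  have hop : hOneAlgHom ρ (a • 1 + b • c) = a • 1 + b • (bettiCohomology.map ψ.hom.hom.hom 1).hom := by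
    rw [map_add, map_smul, map_smul, map_one, hψ]
  have hsc : σ (a • 1 + b • c) = (a : ℂ) + (b : ℂ) * σ c := by
    rw [Rat.smul_one_eq_cast, Rat.smul_def, map_add, map_mul, map_ratCast, map_ratCast]
  have hqa : ∀ (q : ℚ) (y : ℂ ⊗[ℚ] bettiCohomology A.X 1), q • y = (q : ℂ) • y := fun q y => by
    rw [← algebraMap_smul ℂ q y, eq_ratCast]
  rw [Module.End.mem_eigenspace_iff, hop, hsc, LinearMap.baseChange_add, LinearMap.add_apply, LinearMap.baseChange_smul,
    LinearMap.baseChange_smul, LinearMap.smul_apply, LinearMap.smul_apply, LinearMap.baseChange_one, Module.End.one_apply, hx,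
    hqa, hqa, smul_smul, add_smul]

omit [HodgeTensorFacts.{0, 0}] in
/-- **Multiplicities through a generator**: `n_σ = eigenMultiplicity A ψ (σ c)` for the action `hOneEndAction ρ` of the quadratic `K = ℚ(c)`,
`ρ c = ψ`. [cite: Deligne1982HodgeCycles, §4 Prop. 4.4] [cite: MoonenZarhin1999LowDim, §2 (2.3)] -/
theorem multiplicity_hOneEndAction_eq_eigenMultiplicity (ρ : K →+* A.endAlgebra) (hK : Module.finrank ℚ K = 2) {c : K} {D : ℕ}
    (hD : 0 < D) (hc : c * c = -((D : ℚ) • 1)) (ψ : A ⟶ A) (hρc : ρ c = AbelianVariety.endAlgebra.of A ψ) (σ : K →+* ℂ) :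
    (hOneEndAction ρ exists_isReal_hodgeModel_holds hodgePQ_independent_of_hodgeModel_holds).multiplicity σ =
      eigenMultiplicity A ψ (σ c) := by
  rw [EndAction.multiplicity, EndAction.eigenPiece, hOneEndAction_ι, iInf_eigenspace_hOneAlgHom_eq ρ hK hD hc ψ hρc σ, inf_comm]
  exact finrank_eigenspace_inf_piece_oneZero_eq_eigenMultiplicity exists_isReal_hodgeModel_holds hodgePQ_independent_of_hodgeModel_holds
    ψ (σ c)

omit [HodgeTensorFacts.{0, 0}] in
/-- `σ(c) = i√D` or `σ(c) = −i√D` for `c² = −D`. [folklore] -/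
theorem apply_eq_or_eq_neg_of_sq_eq_neg {c : K} {D : ℕ} (hc : c * c = -((D : ℚ) • 1)) (σ : K →+* ℂ) :
    σ c = Complex.I * (Real.sqrt D : ℂ) ∨ σ c = -(Complex.I * (Real.sqrt D : ℂ)) := by
  have h1 : σ c * σ c = -(D : ℂ) := by
    rw [← map_mul, hc, map_neg, Nat.cast_smul_eq_nsmul, nsmul_eq_mul, mul_one, map_natCast]
  have h2 : (Complex.I * (Real.sqrt D : ℂ)) * (Complex.I * (Real.sqrt D : ℂ)) = -(D : ℂ) := by
    rw [mul_mul_mul_comm, Complex.I_mul_I, ← Complex.ofReal_mul, Real.mul_self_sqrt (Nat.cast_nonneg D), Complex.ofReal_natCast,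
      neg_one_mul]
  have h : (σ c - Complex.I * (Real.sqrt D : ℂ)) * (σ c + Complex.I * (Real.sqrt D : ℂ)) = 0 := by
    linear_combination h1 - h2
  rcases mul_eq_zero.1 h with h | h
  · exact Or.inl (sub_eq_zero.1 h)
  · exact Or.inr (eq_neg_of_add_eq_zero_left h)

end Quadratic

end Summit.HodgeConjecture.CorCM

end
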